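import Literature.Topology.PlanarFoliations.WalkFence
import HarnessLib

/-!
# Walk fences over a prefix of a walk

Topic: Topology / PlanarFoliations, sequel to `WalkFence.lean`. The walk fence
`StarData.walkFence` over the walk up to the junction `n` was defined under hypotheses on *all*
the links and junctions (`∀ k`, leafwise continuity of `ℓ k` and the turning rule at `J k`). When a
walk is *being constructed* junction by junction, only the hypotheses below `n` are available;
this file provides the same recursion under the bounded hypotheses (`WalkFenceData.succ'`,
`StarData.walkFencePrefix`), with the same normal form at the start (`walkFencePrefix_start`).
The data produced is a `WalkFenceData J ℓ s n` as before, so all consumers apply verbatim.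

All statements are [folklore].
-/

noncomputable section

open Set Filter Function Metric unitInterval
open _root_.Topology
open Literature.Topology.FourManifolds Literature.Topology.FourManifolds.Foliation

namespace Literature.Topology.PlanarFoliations

namespace StarData

variable {X : Type*} [TopologicalSpace X] [Nonempty X] {F : Foliation ℝ X} {ι : X → ℂ}
variable {B : Type*} [NormedAddCommGroup B] [NormedSpace ℝ B] {M : Type*} [TopologicalSpace M] {T : Foliation B M} {g : ℂ → M}
variable (D : StarData F ι T g) {hι : IsOpenEmbedding ι}
variable (ho : F.IsTransverselyOriented) {J : ℕ → D.WalkJunction hι}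
  {ℓ : ∀ k, Path (J k).Kout.base (J (k + 1)).Kin.base} {s : ℝ}

/-- The chosen edge fence after the walk fence `W`, over the link `ℓ n` (leafwise continuity of
this link only). [folklore] -/
def WalkFenceData.edge' {n : ℕ} (W : D.WalkFenceData J ℓ s n) (hℓn : Continuous (toLeafSpace ∘ ℓ n : I → F.LeafSpace)) :
    D.EdgeFence hι (J n).hv (J n).Kout (J (n + 1)).hv (J (n + 1)).Kin (ℓ n) W.χ (J 0).τ₀ :=
  D.edgeFence hι (J n).hv (J n).Kout ho (J n).hβ (J (n + 1)).hv (J (n + 1)).Kin (J (n + 1)).hβ (ℓ n) hℓn W.χ W.χ_apply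

/-- The level radius of the extended walk fence, before division by `4`. [folklore] -/
def WalkFenceData.succRadius' {n : ℕ} (W : D.WalkFenceData J ℓ s n) (hℓn : Continuous (toLeafSpace ∘ ℓ n : I → F.LeafSpace)) : ℝ :=
  min W.ε (min (D.icRadius (J n).hv W.χ W.χ_apply / 4) (W.edge' D ho hℓn).ε)

/-- **The walk fence extended by the gate of `J n` and the edge fence over `ℓ n`**, under the
hypotheses at `n` only. [folklore] -/
def WalkFenceData.succ' (hs : s = 1 ∨ s = -1) {n : ℕ} (W : D.WalkFenceData J ℓ s n)
    (hℓn : Continuous (toLeafSpace ∘ ℓ n : I → F.LeafSpace)) (hturnn : (J n).jout = (J n).turn s) : D.WalkFenceData J ℓ s (n + 1) :=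
  have h := D.walkFence_step hs (J n) (J (n + 1)) hturnn (ℓ n) W.χ W.χ_apply W.ε_pos W.Γ W.isFenceOn W.Φ_one
    (fun τ hτ hsτ ↦ ⟨(W.track τ hτ hsτ).1, (W.track τ hτ hsτ).2.1, (W.track τ hτ hsτ).2.2.2.1⟩) (W.edge' D ho hℓn)
  have hε4 : W.succRadius' D ho hℓn / 4 ≤ W.ε := h.2.1
  have hI : Ioo ((J 0).τ₀ - W.succRadius' D ho hℓn / 4) ((J 0).τ₀ + W.succRadius' D ho hℓn / 4) ⊆
      Ioo ((J 0).τ₀ - W.ε) ((J 0).τ₀ + W.ε) :=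
    Ioo_subset_Ioo (by linarith) (by linarith)
  { χ := (W.edge' D ho hℓn).χ'
    ε := W.succRadius' D ho hℓn / 4
    Γ := (W.Γ.trans (D.gatePath (J n).hv W.χ_apply (J n).hβ)).trans (W.edge' D ho hℓn).Γ
    Φ := transFence (transFence W.Φ (D.gateFence (J n).hv (J n).jin (J n).jout (J n).β W.χ)) (W.edge' D ho hℓn).Φ
    Ψ := transFence (transFence W.Ψ (D.gateΨ hι (J n).hv (J n).jin (J n).jout (J n).β W.χ)) (W.edge' D ho hℓn).Ψ
    χ_apply := (W.edge' D ho hℓn).χ'_apply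
    ε_pos := h.1
    isFenceOn := h.2.2.1
    Φ_zero := fun τ hτ ↦ by rw [h.2.2.2.1]; exact W.Φ_zero τ (hI hτ)
    Φ_one := h.2.2.2.2.2.1
    Φ_zero_mem := fun τ hτ ↦ by rw [h.2.2.2.1]; exact W.Φ_zero_mem τ (hI hτ)
    track := fun τ hτ hsτ ↦ by
      obtain ⟨h₁, h₂, h₃, h₄⟩ := h.2.2.2.2.2.2.1 τ hτ hsτ
      obtain ⟨-, -, h₅, -, h₆, -⟩ := W.track τ (hI hτ) hsτ
      exact ⟨h₁, h₂, by rw [h.2.2.2.2.1]; exact h₅, h₃, h₆, h₄⟩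
    Φ_base := fun θ ↦ by
      rw [h.2.2.2.2.2.2.2 θ]
      show _ = transFun (transFun (D.walkBase J ℓ n) (J n).gateBase)
        (fun θ ↦ g (ι (transFun (transFun (fun _ ↦ (J n).Kout.base) (ℓ n)) (fun _ ↦ (J (n + 1)).Kin.base) θ))) θ
      exact transFun_congr (fun θ' ↦ transFun_congr (fun θ'' ↦ W.Φ_base θ'') (fun _ ↦ rfl) θ') (fun _ ↦ rfl) θ }

/-- **The walk fence over a prefix**: the walk fence up to the junction `n` under the link and
turning hypotheses below `n` only. [folklore] -/
def walkFencePrefix (hs : s = 1 ∨ s = -1) : (n : ℕ) → (∀ k < n, Continuous (toLeafSpace ∘ ℓ k : I → F.LeafSpace)) →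
    (∀ k < n, (J k).jout = (J k).turn s) → D.WalkFenceData J ℓ s n
  | 0, _, _ => WalkFenceData.zero s
  | n + 1, hℓ, hturn =>
    (walkFencePrefix hs n (fun k hk ↦ hℓ k (Nat.lt_succ_of_lt hk)) (fun k hk ↦ hturn k (Nat.lt_succ_of_lt hk))).succ' D ho hs
      (hℓ n n.lt_succ_self) (hturn n n.lt_succ_self)

/-- **The normal form of the prefix walk fence at its start.** [folklore] -/
theorem walkFencePrefix_start (hs : s = 1 ∨ s = -1) (n : ℕ) (hℓ : ∀ k < n, Continuous (toLeafSpace ∘ ℓ k : I → F.LeafSpace)) (hturn : ∀ k < n, (J k).jout = (J k).turn s) :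
    ((D.walkFencePrefix ho hs n hℓ hturn).Γ 0).germ = ↑(height (D.box (J 0).v)) ∧
      ofLeafSpace ((D.walkFencePrefix ho hs n hℓ hturn).Γ 0).pt ∈ plaque (D.box (J 0).v) (J 0).τ₀ := by
  rw [(D.walkFencePrefix ho hs n hℓ hturn).Γ.source]
  exact ⟨(J 0).start_germ, (J 0).start_pt_mem⟩

end StarData

end Literature.Topology.PlanarFoliations
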